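import Literature.AnabelianGeometry.SemiGraphs.QuasiTemperoidsThmA4CechQuotientLimits
import Literature.AnabelianGeometry.SemiGraphs.BTempCechCofork
import Literature.AnabelianGeometry.SemiGraphs.BTempProdColimits
import Literature.AnabelianGeometry.SemiGraphs.OverPrimeDownwardClosed
import Literature.AnabelianGeometry.SemiGraphs.QuasiTemperoidsThmA4OfEngine
import Literature.AnabelianGeometry.SemiGraphs.QuasiTemperoidsComponents
import HarnessLib

/-!
# Semi-graphs of anabelioids, Appendix: Theorem A.4 — the Čech-extension ENGINE (parallel convention
# `A ⨯ X`), an independent kernel proof of the hypothesis `hE` of `ThmA4Chart.thmA4_of_engine′`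

Mochizuki, *Semi-graphs of anabelioids*, Publ. RIMS **42** (2006) 221–322, Appendix, Theorem A.4
(manuscript pp. 82–86, PRIMS pp. 312–316) [cite: MochizukiSemiAnbd2006, Thm A.4 pp.82-86]: "let `Tᵢ` be a
connected temperoid; let `Aᵢ` be a connected object of `Tᵢ`; `λᵢ : Qᵢ := Tᵢ[Aᵢ] → Tᵢ` … Then any morphism
of quasi-temperoids `φ : Q₁ → Q₂` fits into a 1-commutative diagram [`λ₂ ∘ φ ≅ ψ ∘ λ₁`] — where the
morphism of temperoids `ψ : T₁ → T₂` … is unique, up to unique isomorphism."  PROOF-ONLY file proving,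
UNCONDITIONALLY and WITHOUT a Galois-countability hypothesis, the engine hypothesis `hE` of
`ThmA4Chart.thmA4_of_engine′` (`QuasiTemperoidsThmA4OfEngine.lean`), from which the tree's named fact
`ThmA4` (`QuasiTemperoidsQDPairs.lean`; abc-iut FACT-LIST F-1634) follows by `thmA4_of_engine′ cechEngine`
— by the Čech route in the parallel convention `A ⨯ X` (row A4-∃, owner abc-iut-w4-d110):

* `cechExt_engine` / `cechEngine` — for topological groups `Π₁, Π₂` (temperedness not used), `A₁`
  connected, `A₂` connected (only a point is used), and `F : B^temp(Π₂)[A₂] ⥤ B^temp(Π₁)[A₁]` preserving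
  finite limits, countable colimits and nondegenerate objects, the concrete Čech extension
  `Ψ := cechExt A₂ (F ⋙ λ₁)` (`X ↦ coeq(F(A₂ ⨯ (A₂ ⨯ X)) ⇉ F(A₂ ⨯ X))`) preserves finite limits
  (`QuasiTemperoidsThmA4CechQuotientLimits.lean`) and countable colimits (`A₂ ⨯ (−)` does,
  `BTempProdColimits.lean`; `λ₁` does, `OverPrimeDownwardClosed.lean`) and satisfies `F ⋙ λ₁ ≅ λ₂ ⋙ Ψ`
  (the Čech coforks are coequalizers, `BTempCechCofork.lean`) — EXACTLY the engine binder `hE` of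
  abc-iut-w5-d129's `ThmA4Chart.thmA4_of_engine′` (`QuasiTemperoidsThmA4OfEngine.lean`);
* the closer `thmA4_holds : ThmA4` itself is NOT restated here: by the L3 lead's ruling α23 the name and
  statement belong to the first accepted closer, abc-iut-w5-d129's `QuasiTemperoidsThmA4Holds.lean` (team
  stack, convention `X ⨯ A`, engine `ThmA4Cech.cechFiniteLimits`); this file is the SECOND, independent
  kernel proof of the same engine statement (first kernel-clean end-to-end 2026-08-26T04:20Z), and
  `ThmA4Chart.thmA4_of_engine′ cechEngine : ThmA4` elaborates.

HONEST FRAMING: this is the Appendix of [SemiAnbd] (elementary category theory of `Π`-sets); nothing here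
refers to the IUT corpus proper and no side is taken on [IUTchIII] Cor. 3.12.
-/

open CategoryTheory CategoryTheory.Limits

namespace Literature.AnabelianGeometry.SemiGraphs

universe v₁ v₂ u u₁ u₂

section Engine

open Literature.AlgebraicGeometry.Frobenioids (IsConnectedObj IsNonemptyObj)
open Literature.AlgebraicGeometry.Frobenioids.QuasiTemperoid.BTempConnected (nonempty_of_isConnectedObj)

/-- The object `(A, 𝟙)` of `C[A]` is nondegenerate (Def. A.1 (ii)): every connected `B` of `C[A]`
receives `𝟙 : B → B` and maps to `A`. [cite: MochizukiSemiAnbd2006, Def A.1(ii) p.79] -/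
theorem isNondegenerateObj_overPrime_self {C : Type u₁} [Category.{v₁} C] (A : C) :
    IsNondegenerateObj (⟨A, ⟨𝟙 A⟩⟩ : Over' A) :=
  fun B hB => ⟨B, hB, ⟨𝟙 B⟩, ⟨ObjectProperty.homMk B.property.some⟩⟩

/-- **The Čech-extension engine for Theorem A.4 (model case).** For topological groups `Π₁, Π₂`,
`A₁ ∈ B^temp(Π₁)` connected, `A₂ ∈ B^temp(Π₂)` with a point, and a functor
`F : B^temp(Π₂)[A₂] ⥤ B^temp(Π₁)[A₁]` preserving finite limits, countable colimits and nondegenerate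
objects, the Čech extension `ψ^* := cechExt A₂ (F ⋙ λ₁)` is a functor `B^temp(Π₂) ⥤ B^temp(Π₁)`
preserving finite limits and countable colimits with `F ⋙ λ₁ ≅ λ₂ ⋙ ψ^*`.  No Galois-countability and
no temperedness hypothesis is used. [cite: MochizukiSemiAnbd2006, Thm A.4 pp.82-86] -/
theorem cechExt_engine {G₁ : Type u} [Group G₁] [TopologicalSpace G₁] [IsTopologicalGroup G₁]
    {G₂ : Type u} [Group G₂] [TopologicalSpace G₂] [IsTopologicalGroup G₂]
    {A₁ : BTemp G₁} (hA₁ : IsConnectedObj A₁) {A₂ : BTemp G₂} (a₂ : A₂.obj.V)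
    (F : Over' A₂ ⥤ Over' A₁) (hlim : PreservesFiniteLimits F)
    (hcolim : ∀ (J : Type) [SmallCategory J] [CountableCategory J], PreservesColimitsOfShape J F)
    (hnd : ∀ X : Over' A₂, IsNondegenerateObj X → IsNondegenerateObj (F.obj X)) :
    ∃ Ψ : BTemp G₂ ⥤ BTemp G₁, PreservesFiniteLimits Ψ ∧
      (∀ (J : Type) [SmallCategory J] [CountableCategory J], PreservesColimitsOfShape J Ψ) ∧
      Nonempty (F ⋙ (admitsHomTo A₁).ι ≅ (admitsHomTo A₂).ι ⋙ Ψ) := by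
  haveI : HasFiniteLimits (BTemp G₂) := BTemp.hasFiniteLimits
  haveI : HasFiniteLimits (BTemp G₁) := BTemp.hasFiniteLimits
  haveI := BTemp.hasColimitsOfShape_of_countable (G := G₁) WalkingParallelPair
  haveI := hlim
  -- the functor `K = F ⋙ λ₁` and its preservation properties
  let K : Over' A₂ ⥤ BTemp G₁ := F ⋙ (admitsHomTo A₁).ι
  haveI := preservesLimitsOfShape_ι A₁ WalkingCospan.one
  haveI := preservesLimitsOfShape_ι A₁ (⟨WalkingPair.left⟩ : Discrete WalkingPair)
  haveI := preservesColimitsOfShape_ι A₁ (J := WalkingParallelPair)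
  haveI : PreservesColimitsOfShape WalkingParallelPair F := hcolim WalkingParallelPair
  haveI : PreservesLimitsOfShape WalkingCospan K := inferInstance
  haveI : PreservesLimitsOfShape (Discrete WalkingPair) K := inferInstance
  haveI : PreservesColimitsOfShape WalkingParallelPair K := inferInstance
  -- `K(A₂)` has a point
  have hne : Nonempty (K.obj ⟨A₂, ⟨𝟙 A₂⟩⟩).obj.V := by
    obtain ⟨C, hC, -, ⟨k⟩⟩ := hnd _ (isNondegenerateObj_overPrime_self A₂) ⟨A₁, ⟨𝟙 A₁⟩⟩
      (overPrime_isConnectedObj_of_isConnectedObj _ hA₁)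
    obtain ⟨⟨c⟩, -⟩ := (overPrime_isConnectedObj_iff_transitive C).mp hC
    exact ⟨(k.hom.hom.hom c : _)⟩
  refine ⟨cechExt A₂ K, preservesFiniteLimits_cechExt A₂ K hne, fun J _ _ => ?_, ⟨?_⟩⟩
  · -- countable colimits
    haveI := BTemp.hasColimitsOfShape_of_countable (G := G₁) J
    haveI : PreservesColimitsOfShape J F := hcolim J
    haveI := preservesColimitsOfShape_ι A₁ (J := J)
    haveI := BTemp.preservesColimitsOfShape_prodFunctor_obj_of_countableCategory A₂ J
    haveI : PreservesColimitsOfShape J (cechZero A₂ ⋙ (admitsHomTo A₂).ι) :=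
      preservesColimitsOfShape_of_natIso (cechZeroCompιIso A₂).symm
    haveI : PreservesColimitsOfShape J (cechOne A₂ ⋙ (admitsHomTo A₂).ι) :=
      preservesColimitsOfShape_of_natIso (cechOneCompιIso A₂).symm
    haveI : PreservesColimitsOfShape J (cechZero A₂) :=
      preservesColimitsOfShape_of_reflects_of_preserves _ (admitsHomTo A₂).ι
    haveI : PreservesColimitsOfShape J (cechOne A₂) :=
      preservesColimitsOfShape_of_reflects_of_preserves _ (admitsHomTo A₂).ι
    exact preservesColimitsOfShape_cechExt A₂ K J
  · -- the 1-commutation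
    refine (cechExtIso A₂ K fun B => ?_).symm
    exact isColimitOfIsColimitCoforkMap (admitsHomTo A₂).ι _
      (BTemp.nonempty_isColimit_cechCofork A₂ B.obj a₂).some

/-- **The engine in the binder shape of `ThmA4Chart.thmA4_of_engine'`** (tempered `Πᵢ`, connected
`Aᵢ`; the temperedness hypotheses are not used, and of `A₂` only a point).
[cite: MochizukiSemiAnbd2006, Thm A.4 pp.82-86] -/
theorem cechEngine {G₁ : Type u} [Group G₁] [TopologicalSpace G₁] [IsTopologicalGroup G₁]
    {G₂ : Type u} [Group G₂] [TopologicalSpace G₂] [IsTopologicalGroup G₂]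
    (_ : IsTempered G₁) (_ : IsTempered G₂)
    {A₁ : BTemp G₁} (hA₁ : IsConnectedObj A₁) {A₂ : BTemp G₂} (hA₂ : IsConnectedObj A₂)
    (F : Over' A₂ ⥤ Over' A₁) (hlim : PreservesFiniteLimits F)
    (hcolim : ∀ (J : Type) [SmallCategory J] [CountableCategory J], PreservesColimitsOfShape J F)
    (hnd : ∀ X : Over' A₂, IsNondegenerateObj X → IsNondegenerateObj (F.obj X)) :
    ∃ Ψ : BTemp G₂ ⥤ BTemp G₁, PreservesFiniteLimits Ψ ∧
      (∀ (J : Type) [SmallCategory J] [CountableCategory J], PreservesColimitsOfShape J Ψ) ∧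
      Nonempty (F ⋙ (admitsHomTo A₁).ι ≅ (admitsHomTo A₂).ι ⋙ Ψ) := by
  obtain ⟨a₂⟩ := (BTemp.isNonemptyObj_iff A₂).mp hA₂.1
  exact cechExt_engine hA₁ a₂ F hlim hcolim hnd

end Engine

end Literature.AnabelianGeometry.SemiGraphs
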